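import Summits.ResolutionOfSingularities.ResolutionOfSingularities.Theorems.HomologicalConductorNoZenoRFirstKindGermLift
import Summits.ResolutionOfSingularities.ResolutionOfSingularities.Theorems.HomologicalConductorNoZenoRMinimalNoFirstKindOfStep
import HarnessLib

/-!
# Crux `NoZenoR` (stmt-ResolutionOfSingularities-19943) — the localisation step `hstep` of `…MinimalNoFirstKindOfStep`
# ASSEMBLED modulo ONE explicit `h⁰`-transfer hypothesis; hence (M₀) and the W3 print `Lipman1969_27_3_rat.{0}` modulo it

Route `ResolutionOfSingularities/HomologicalConductor` (cell decomp-res, hand leafhand-res-homologicalconduct-24 g0).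
OURS: AI-written assembly over tree theorems, weaker than expert review; nothing here is a statement of the manuscript
under review (Hironaka 2017).  SUPPORT level, counted 0.  Def-free; no named Literature fact; CONDITIONAL on the explicit
hypothesis `hT` (the `h⁰`-transfer (H0T) of memo MEMO-19943-hand24g0-M0-ROAD.md):

  (H0T) for a desingularization `π : X → Spec S` of a non-regular rational `S`, its domination `σ : X → V = Bl_𝔪 Spec S`,
  a first-kind `η ∈ excCurvePoints π` and a point `η₁` of the germ `X ×_V Spec 𝒪_{V,σ η}` over `η` which is an integral
  exceptional curve of the germ resolution `π₁`: `h0 π₁ (𝓘_{η₁}²) = 3·h0 π₁ 𝓘_{η₁}` (lengths over `𝒪_{V,σ η}`; the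
  res-L0-w44 germ package proves this shape over an affine chart, `ExcCount.h0_primeDivisorIdeal_sq_eq_three_mul_of_fst`).

* `step_of_h0Transfer` — (H0T) ⇒ `hstep`: with `v = σ η` (closed, [G]), `S₁ = 𝒪_{V,v}` (normal (8.1), rational (1.2),
  of dimension `2` if non-regular), `X₁` the germ, `π₁` MINIMAL ([U] `isMinimalResolution_germ_of_isMinimalResolution`),
  `η₁` the lift of `η` and the count drop (`…FirstKindGermLift`); a REGULAR `v` is contradictory (minimal over regular ⇒
  isomorphism ⇒ no exceptional curve);
* **`not_firstKind_of_isMinimalResolution_of_h0Transfer`**, **`Lipman1969_27_3_rat_of_h0Transfer`** — (H0T) ⇒ (M₀) and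
  (H0T) ⇒ `Lipman1969_27_3_rat.{0}`.

No crux or summit statement is proved here; (H0T) is NOT proved here.
-/

noncomputable section

-- single-problem summit: the doubled namespace component `ResolutionOfSingularities` is forced
set_option linter.dupNamespace false

open CategoryTheory CategoryTheory.Limits AlgebraicGeometry TopologicalSpace IsLocalRing
open Literature.AlgebraicGeometry Literature.AlgebraicGeometry.Resolution

namespace Summit.ResolutionOfSingularities.ResolutionOfSingularities.Theorems.NoZeno.FirstKind

/-- **`hstep` from the `h⁰`-transfer (H0T).** [cite: Lipman1969, Corollary (27.3) (p. 277); Section 2, (*) (p. 203)] -/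
theorem step_of_h0Transfer
    (hT : ∀ (S : Type) [CommRing S] [IsNoetherianRing S] [IsLocalRing S] [IsDomain S] [IsIntegrallyClosed S],
      ringKrullDim S = 2 → HasRationalSingularity S → ¬ IsRegularLocalRing S →
      ∀ (X : Scheme.{0}) (π : X ⟶ Spec (.of S)), IsResolution π →
      ∀ (σ : X ⟶ affineBlowup (maximalIdeal S)), σ ≫ affineBlowup.π (maximalIdeal S) = π → IsResolution σ →
      ∀ η ∈ excCurvePoints π, h0 π (primeDivisorIdeal η ^ 2) = 3 * h0 π (primeDivisorIdeal η) →
      ∀ η₁ : ↑(pullback σ ((affineBlowup (maximalIdeal S)).fromSpecStalk (σ.base η))),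
        (pullback.fst σ ((affineBlowup (maximalIdeal S)).fromSpecStalk (σ.base η))).base η₁ = η →
        η₁ ∈ excCurvePoints (A := (affineBlowup (maximalIdeal S)).presheaf.stalk (σ.base η))
          (pullback.snd σ ((affineBlowup (maximalIdeal S)).fromSpecStalk (σ.base η))) →
        h0 (pullback.snd σ ((affineBlowup (maximalIdeal S)).fromSpecStalk (σ.base η))) (primeDivisorIdeal η₁ ^ 2) =
          3 * h0 (pullback.snd σ ((affineBlowup (maximalIdeal S)).fromSpecStalk (σ.base η))) (primeDivisorIdeal η₁))
    (S : Type) [CommRing S] [IsNoetherianRing S] [IsLocalRing S] [IsDomain S] [IsIntegrallyClosed S]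
    (hdim : ringKrullDim S = 2) (hrat : HasRationalSingularity S) (hsing : ¬ IsRegularLocalRing S)
    (X : Scheme.{0}) (π : X ⟶ Spec (.of S)) (hπ : IsMinimalResolution π)
    (η : X) (hη : η ∈ excCurvePoints π) (hfk : h0 π (primeDivisorIdeal η ^ 2) = 3 * h0 π (primeDivisorIdeal η)) :
    ∃ (S₁ : Type) (_ : CommRing S₁) (_ : IsNoetherianRing S₁) (_ : IsLocalRing S₁) (_ : IsDomain S₁)
      (_ : IsIntegrallyClosed S₁), ringKrullDim S₁ = 2 ∧ HasRationalSingularity S₁ ∧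
      ∃ (X₁ : Scheme.{0}) (π₁ : X₁ ⟶ Spec (.of S₁)), IsMinimalResolution π₁ ∧
        (excCurvePoints π₁).ncard < (excCurvePoints π).ncard ∧
        ∃ η₁ ∈ excCurvePoints π₁, h0 π₁ (primeDivisorIdeal η₁ ^ 2) = 3 * h0 π₁ (primeDivisorIdeal η₁) := by
  -- the domination `σ : X → V = Bl_𝔪 Spec S`
  obtain ⟨σ, hσ, hσres⟩ := QuadraticTransform.exists_isResolution_fac_of_isBlowup_maximalIdeal π hdim hrat hsing hπ.1
    (affineBlowup.isBlowup (maximalIdeal S))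
  have hb : IsBlowup (affineBlowup.π (maximalIdeal S)) (affineBlowup.idealSheaf (maximalIdeal S)) :=
    affineBlowup.isBlowup _
  have hI0 := affineBlowupIdealSheaf_maximalIdeal_ne_bot (S := S) hdim
  haveI : IsIntegral (affineBlowup (maximalIdeal S)) := hb.isIntegral hI0
  haveI : IsLocallyNoetherian (affineBlowup (maximalIdeal S)) :=
    LocallyOfFiniteType.isLocallyNoetherian (affineBlowup.π (maximalIdeal S))
  haveI : CompactSpace (affineBlowup (maximalIdeal S)) :=
    QuasiCompact.compactSpace_of_compactSpace (affineBlowup.π (maximalIdeal S))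
  haveI : IsNoetherian (affineBlowup (maximalIdeal S)) := {}
  haveI : IsIntegral X := hπ.1.isIntegral_source
  haveI : IsProper π := hπ.1.isProper
  haveI : IsLocallyNoetherian X := LocallyOfFiniteType.isLocallyNoetherian π
  haveI : IsProper σ := hσres.isProper
  have hbir : IsBirational (affineBlowup.π (maximalIdeal S)) := hb.isBirational' hI0
  -- the closed point `v = σ η` and the germ
  set v := σ.base η with hvdef
  have hvc : IsClosed ({v} : Set (affineBlowup (maximalIdeal S))) :=
    isClosed_singleton_apply_of_firstKind π hdim hrat hsing hπ.1 hb σ hσ hη hfk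
  haveI hvn : IsIntegrallyClosed ((affineBlowup (maximalIdeal S)).presheaf.stalk v) :=
    QuadraticTransform.Lipman1969_8_1_holds S hdim hrat v
  have hmin₁ : IsMinimalResolution (pullback.snd σ ((affineBlowup (maximalIdeal S)).fromSpecStalk v)) :=
    isMinimalResolution_germ_of_isMinimalResolution π hdim hrat hπ σ hσ hσres v hvc
  -- the lift of `η`
  obtain ⟨η₁, hη₁, hη₁η⟩ := exists_mem_excCurvePoints_germ_fst_eq π σ v hvc hη rfl
  by_cases hvreg : IsRegularLocalRing ((affineBlowup (maximalIdeal S)).presheaf.stalk v)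
  · -- a regular `v` is contradictory: the minimal germ is an isomorphism, without exceptional curves
    exfalso
    haveI : IsRegularRing (CommRingCat.of ((affineBlowup (maximalIdeal S)).presheaf.stalk v)) :=
      isRegularRing_of_isRegularLocalRing _
    haveI := ExcCount.isIso_of_isMinimalResolution_of_isRegular hmin₁ (Scheme.isRegular_Spec _)
    -- an isomorphism has no exceptional curve: the point `η₁` over the closed point would have height `0`
    have h0' : Order.height η₁ = 0 := ExcCount.height_eq_zero_of_forall_specializes η₁ fun y => by
      have hy : (pullback.snd σ ((affineBlowup (maximalIdeal S)).fromSpecStalk v)).base y ⤳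
          (pullback.snd σ ((affineBlowup (maximalIdeal S)).fromSpecStalk v)).base η₁ := by
        rw [hη₁.1]
        exact (PrimeSpectrum.le_iff_specializes _ _).mp (IsLocalRing.le_maximalIdeal
          ((pullback.snd σ ((affineBlowup (maximalIdeal S)).fromSpecStalk v)).base y).2.ne_top)
      exact (pullback.snd σ ((affineBlowup (maximalIdeal S)).fromSpecStalk v)).isOpenEmbedding.isInducing.specializes_iff.mp
        hy
    have h1 := hη₁.2
    rw [h0'] at h1
    exact zero_ne_one h1
  · have hdim₁ : ringKrullDim ((affineBlowup (maximalIdeal S)).presheaf.stalk v) = 2 :=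
      QuadraticTransform.ringKrullDim_stalk_eq_two_of_not_isRegularLocalRing hdim (affineBlowup.π (maximalIdeal S))
        hbir hvn hvreg
    have hrat₁ : HasRationalSingularity ((affineBlowup (maximalIdeal S)).presheaf.stalk v) :=
      QuadraticTransform.hasRationalSingularity_stalk_of_stage (affineBlowup.π (maximalIdeal S)) hdim hrat hbir v
        hvn hdim₁
    have hlt := ncard_excCurvePoints_germ_lt π σ (affineBlowup.π (maximalIdeal S)) hσ v hvc hdim hrat hsing hπ.1
      hb hη hfk rfl
    have hfk₁ := hT S hdim hrat hsing X π hπ.1 σ hσ hσres η hη hfk η₁ hη₁η hη₁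
    exact ⟨(affineBlowup (maximalIdeal S)).presheaf.stalk v, inferInstance, inferInstance, inferInstance,
      inferInstance, hvn, hdim₁, hrat₁, _, _, hmin₁, hlt, η₁, hη₁, hfk₁⟩

/-- **(M₀) modulo (H0T)**: no first-kind curve on a minimal desingularization of a rational surface singularity.
[cite: Lipman1969, Corollary (27.3) (p. 277)] -/
theorem not_firstKind_of_isMinimalResolution_of_h0Transfer
    (hT : ∀ (S : Type) [CommRing S] [IsNoetherianRing S] [IsLocalRing S] [IsDomain S] [IsIntegrallyClosed S],
      ringKrullDim S = 2 → HasRationalSingularity S → ¬ IsRegularLocalRing S →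
      ∀ (X : Scheme.{0}) (π : X ⟶ Spec (.of S)), IsResolution π →
      ∀ (σ : X ⟶ affineBlowup (maximalIdeal S)), σ ≫ affineBlowup.π (maximalIdeal S) = π → IsResolution σ →
      ∀ η ∈ excCurvePoints π, h0 π (primeDivisorIdeal η ^ 2) = 3 * h0 π (primeDivisorIdeal η) →
      ∀ η₁ : ↑(pullback σ ((affineBlowup (maximalIdeal S)).fromSpecStalk (σ.base η))),
        (pullback.fst σ ((affineBlowup (maximalIdeal S)).fromSpecStalk (σ.base η))).base η₁ = η →
        η₁ ∈ excCurvePoints (A := (affineBlowup (maximalIdeal S)).presheaf.stalk (σ.base η))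
          (pullback.snd σ ((affineBlowup (maximalIdeal S)).fromSpecStalk (σ.base η))) →
        h0 (pullback.snd σ ((affineBlowup (maximalIdeal S)).fromSpecStalk (σ.base η))) (primeDivisorIdeal η₁ ^ 2) =
          3 * h0 (pullback.snd σ ((affineBlowup (maximalIdeal S)).fromSpecStalk (σ.base η))) (primeDivisorIdeal η₁))
    (S : Type) [CommRing S] [IsNoetherianRing S] [IsLocalRing S] [IsDomain S] [IsIntegrallyClosed S]
    (hdim : ringKrullDim S = 2) (hrat : HasRationalSingularity S)
    {X : Scheme.{0}} {π : X ⟶ Spec (.of S)} (hπ : IsMinimalResolution π) {η : X} (hη : η ∈ excCurvePoints π) :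
    h0 π (primeDivisorIdeal η ^ 2) ≠ 3 * h0 π (primeDivisorIdeal η) :=
  not_firstKind_of_isMinimalResolution_of_step (step_of_h0Transfer hT) S hdim hrat hπ hη

/-- **The W3 print `Lipman1969_27_3_rat.{0}` modulo (H0T).** [cite: Lipman1969, Corollary (27.3) (p. 277)] -/
theorem Lipman1969_27_3_rat_of_h0Transfer
    (hT : ∀ (S : Type) [CommRing S] [IsNoetherianRing S] [IsLocalRing S] [IsDomain S] [IsIntegrallyClosed S],
      ringKrullDim S = 2 → HasRationalSingularity S → ¬ IsRegularLocalRing S →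
      ∀ (X : Scheme.{0}) (π : X ⟶ Spec (.of S)), IsResolution π →
      ∀ (σ : X ⟶ affineBlowup (maximalIdeal S)), σ ≫ affineBlowup.π (maximalIdeal S) = π → IsResolution σ →
      ∀ η ∈ excCurvePoints π, h0 π (primeDivisorIdeal η ^ 2) = 3 * h0 π (primeDivisorIdeal η) →
      ∀ η₁ : ↑(pullback σ ((affineBlowup (maximalIdeal S)).fromSpecStalk (σ.base η))),
        (pullback.fst σ ((affineBlowup (maximalIdeal S)).fromSpecStalk (σ.base η))).base η₁ = η →
        η₁ ∈ excCurvePoints (A := (affineBlowup (maximalIdeal S)).presheaf.stalk (σ.base η))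
          (pullback.snd σ ((affineBlowup (maximalIdeal S)).fromSpecStalk (σ.base η))) →
        h0 (pullback.snd σ ((affineBlowup (maximalIdeal S)).fromSpecStalk (σ.base η))) (primeDivisorIdeal η₁ ^ 2) =
          3 * h0 (pullback.snd σ ((affineBlowup (maximalIdeal S)).fromSpecStalk (σ.base η))) (primeDivisorIdeal η₁)) :
    Lipman1969_27_3_rat.{0} :=
  Lipman1969_27_3_rat_of_step (step_of_h0Transfer hT)

end Summit.ResolutionOfSingularities.ResolutionOfSingularities.Theorems.NoZeno.FirstKind

end
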